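import Summits.AtomisticToContinuum.Crystallization.Theorems.FrustratedLawDichotomyStrainedPatchHomConvexSegment

/-!
# One-sided SECOND-ORDER expansion of the per-label curvature form along the label's displacement (real side of the centred curvature leaf)

decomp-a2c hand-1 g27 (crux `AperiodicFrustratedLawGap`, stmt-AtomisticToContinuum-27623; `(H) HomFloor (1/625)`, hcp half; lever (C), critic rows
1040 (b) / 1050 (C); hand-1 g27 FINDING «loss budget»).  One label contributes `Q(c) = α(‖c‖)⟪c, Δ⟫² + β(‖c‖)‖Δ‖²` to the curvature sum
(`…HomConvexCurvature.segGd_eq_rankOne`).  Over the leaf's `(U, ξ)`-box the label point moves from the box-centre point `p` to `p + d`.  The centred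
leaf bounds `Q(p + d)` from below by its value and FIRST derivative at `p` minus a ONE-SIDED second-order remainder.  Generic in the coefficient
functions: `A, A₁, A₂` (`α, α′, α″`) and `B, B₁, B₂` (`β, β′, β″`) with `HasDerivAt` links on an open radius interval `(a, b)` containing the tube
`{‖p + t d‖ : t ∈ [0,1]}`:

* §1 path calculus (`…TaylorChord.segR/segS` with direction `d`): `u(t) = ⟪p + t d, Δ⟫`, `u² ≤ ρ²‖Δ‖²`, `|σ| ≤ ‖d‖`, `0 ≤ σ′ ≤ ‖d‖²/ρ`;
* §2 first and second derivative of `g(t) = A(ρ_t)u_t² + B(ρ_t)‖Δ‖²`;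
* §3 the pointwise floor `g″ ≥ −K‖d‖²‖Δ‖²` from `[A₂]₋ρ² + [A₁]₋ρ + 4|A₁|ρ + 2[A]₋ + [B₂]₋ + [B₁]₋/ρ ≤ K` (`[x]₋ = max 0 (−x)`: the
  PSD-signed terms `A₂σ²u²`, `A₁σ′u²`, `2A⟪d,Δ⟫²`, `B₂σ²‖Δ‖²`, `B₁σ′‖Δ‖²` are dropped when their coefficient is `≥ 0`);
* §4 ★★★ `pathForm_secondOrder`: `Q(p + d) ≥ Q(p) + [A₁(ρ₀)(⟪p,d⟫/ρ₀)⟪p,Δ⟫² + 2A(ρ₀)⟪p,Δ⟫⟪d,Δ⟫ + B₁(ρ₀)(⟪p,d⟫/ρ₀)‖Δ‖²] − (K/2)‖d‖²‖Δ‖²`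
  (`ρ₀ = ‖p‖`), by `φ″ ≥ 0 ⇒ φ′ ↑ ⇒ φ ↑` (`…HomConvexSegment.le_of_deriv_nonneg_piece`).

NO definitions; 0 sorry; standard axioms; no instances / notation / `#eval`.  `--supports stmt-AtomisticToContinuum-27623`.
-/

noncomputable section

namespace Summit.AtomisticToContinuum.Crystallization.Theorems.FrustratedLawDichotomyStrainedPatchHomHessPath

open scoped RealInnerProductSpace
open Summit.AtomisticToContinuum.Crystallization.Theorems.FrustratedLawDichotomyStrainedPatchTaylorChord
  (segR segN segS segN_eq_inner hasDerivAt_segR hasDerivAt_segS segS_sq_le segR_continuous)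
open Summit.AtomisticToContinuum.Crystallization.Theorems.FrustratedLawDichotomyStrainedPatchHomConvexSegment (le_of_deriv_nonneg_piece)

/-! ## §1. Path calculus -/

/-- `⟪p + t d, Δ⟫ = ⟪p, Δ⟫ + t⟪d, Δ⟫`. [arithmetic] -/
theorem inner_path_eq (p d Δ : EuclideanSpace ℝ (Fin 3)) (t : ℝ) : ⟪p + t • d, Δ⟫ = ⟪p, Δ⟫ + t * ⟪d, Δ⟫ := by
  rw [inner_add_left, real_inner_smul_left]

/-- `d/dt ⟪p + t d, Δ⟫ = ⟪d, Δ⟫`. [folklore] -/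
theorem hasDerivAt_inner_path (p d Δ : EuclideanSpace ℝ (Fin 3)) (t : ℝ) : HasDerivAt (fun s : ℝ => ⟪p + s • d, Δ⟫) ⟪d, Δ⟫ t := by
  have hfun : (fun s : ℝ => ⟪p + s • d, Δ⟫) = fun s => ⟪p, Δ⟫ + s * ⟪d, Δ⟫ := by funext s; exact inner_path_eq p d Δ s
  rw [hfun]
  exact (((hasDerivAt_id' t).mul_const ⟪d, Δ⟫).const_add ⟪p, Δ⟫).congr_deriv (by ring)

/-- `⟪p + t d, Δ⟫² ≤ ρ_t²‖Δ‖²`. [folklore: Cauchy–Schwarz] -/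
theorem inner_path_sq_le (p d Δ : EuclideanSpace ℝ (Fin 3)) (t : ℝ) : ⟪p + t • d, Δ⟫ ^ 2 ≤ segR p d t ^ 2 * ‖Δ‖ ^ 2 := by
  have h := abs_real_inner_le_norm (p + t • d) Δ
  rw [← sq_abs, segR, ← mul_pow]
  exact pow_le_pow_left₀ (abs_nonneg _) h 2

/-- `⟪d, Δ⟫² ≤ ‖d‖²‖Δ‖²`. [folklore] -/
theorem inner_sq_le_norm (d Δ : EuclideanSpace ℝ (Fin 3)) : ⟪d, Δ⟫ ^ 2 ≤ ‖d‖ ^ 2 * ‖Δ‖ ^ 2 := by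
  have h := abs_real_inner_le_norm d Δ
  rw [← sq_abs, ← mul_pow]
  exact pow_le_pow_left₀ (abs_nonneg _) h 2

/-- `|⟪p + t d, Δ⟫⟪d, Δ⟫| ≤ ρ_t‖d‖‖Δ‖²`. [folklore] -/
theorem abs_inner_path_mul_le (p d Δ : EuclideanSpace ℝ (Fin 3)) (t : ℝ) :
    |⟪p + t • d, Δ⟫ * ⟪d, Δ⟫| ≤ segR p d t * ‖d‖ * ‖Δ‖ ^ 2 := by
  rw [abs_mul]
  have h1 := abs_real_inner_le_norm (p + t • d) Δ
  have h2 := abs_real_inner_le_norm d Δ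
  calc |⟪p + t • d, Δ⟫| * |⟪d, Δ⟫| ≤ (‖p + t • d‖ * ‖Δ‖) * (‖d‖ * ‖Δ‖) := mul_le_mul h1 h2 (abs_nonneg _) (by positivity)
    _ = segR p d t * ‖d‖ * ‖Δ‖ ^ 2 := by rw [segR]; ring

/-- `|σ| ≤ ‖d‖` (`σ = ρ′`). [folklore] -/
theorem abs_segS_le {p d : EuclideanSpace ℝ (Fin 3)} {t : ℝ} (h0 : 0 < segR p d t) : |segS p d t| ≤ ‖d‖ :=
  abs_le_of_sq_le_sq (segS_sq_le (p := p) (Δ := d) h0) (norm_nonneg d)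

/-- The derivative `σ′ = (‖d‖²ρ − Nσ)/ρ²` equals `(‖d‖² − σ²)/ρ`. [arithmetic] -/
theorem segS_deriv_eq {p d : EuclideanSpace ℝ (Fin 3)} {t : ℝ} (h0 : segR p d t ≠ 0) :
    (‖d‖ ^ 2 * segR p d t - segN p d t * segS p d t) / segR p d t ^ 2 = (‖d‖ ^ 2 - segS p d t ^ 2) / segR p d t := by
  rw [segS]
  field_simp

/-- `0 ≤ σ′ ≤ ‖d‖²/ρ`. [folklore] -/
theorem segS_deriv_bounds {p d : EuclideanSpace ℝ (Fin 3)} {t : ℝ} (h0 : 0 < segR p d t) :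
    0 ≤ (‖d‖ ^ 2 * segR p d t - segN p d t * segS p d t) / segR p d t ^ 2 ∧
      (‖d‖ ^ 2 * segR p d t - segN p d t * segS p d t) / segR p d t ^ 2 ≤ ‖d‖ ^ 2 / segR p d t := by
  rw [segS_deriv_eq h0.ne']
  have h := segS_sq_le (p := p) (Δ := d) h0
  constructor
  · exact div_nonneg (by linarith) h0.le
  · exact div_le_div_of_nonneg_right (by nlinarith [sq_nonneg (segS p d t)]) h0.le

/-! ## §2. Derivatives of `g(t) = A(ρ_t)⟪p + t d, Δ⟫² + B(ρ_t)‖Δ‖²` -/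

/-- ★ First derivative: `g′ = A₁(ρ)σ u² + 2A(ρ) u⟪d,Δ⟫ + B₁(ρ)σ‖Δ‖²`. [folklore: chain and product rules] -/
theorem hasDerivAt_pathForm {A A₁ B B₁ : ℝ → ℝ} {p d Δ : EuclideanSpace ℝ (Fin 3)} {t : ℝ} (h0 : segR p d t ≠ 0)
    (hA : HasDerivAt A (A₁ (segR p d t)) (segR p d t)) (hB : HasDerivAt B (B₁ (segR p d t)) (segR p d t)) :
    HasDerivAt (fun s : ℝ => A (segR p d s) * ⟪p + s • d, Δ⟫ ^ 2 + B (segR p d s) * ‖Δ‖ ^ 2)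
      (A₁ (segR p d t) * segS p d t * ⟪p + t • d, Δ⟫ ^ 2 + 2 * A (segR p d t) * (⟪p + t • d, Δ⟫ * ⟪d, Δ⟫) +
        B₁ (segR p d t) * segS p d t * ‖Δ‖ ^ 2) t := by
  have hρ := hasDerivAt_segR (p := p) (Δ := d) h0
  have hAc : HasDerivAt (fun s => A (segR p d s)) (A₁ (segR p d t) * segS p d t) t := hA.comp t hρ
  have hBc : HasDerivAt (fun s => B (segR p d s)) (B₁ (segR p d t) * segS p d t) t := hB.comp t hρ
  have hu := hasDerivAt_inner_path p d Δ t
  have h := (hAc.mul (hu.mul hu)).add (hBc.mul_const (‖Δ‖ ^ 2))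
  have hfun : (fun s : ℝ => A (segR p d s) * ⟪p + s • d, Δ⟫ ^ 2 + B (segR p d s) * ‖Δ‖ ^ 2) =
      fun s => A (segR p d s) * (⟪p + s • d, Δ⟫ * ⟪p + s • d, Δ⟫) + B (segR p d s) * ‖Δ‖ ^ 2 := by
    funext s; ring
  rw [hfun]
  exact h.congr_deriv (by simp only [Pi.mul_apply]; ring)

/-- ★ Second derivative: with `σ′ = (‖d‖²ρ − Nσ)/ρ²`,
`g″ = (A₂σ² + A₁σ′)u² + 4A₁σ u⟪d,Δ⟫ + 2A⟪d,Δ⟫² + (B₂σ² + B₁σ′)‖Δ‖²`. [folklore: chain and product rules] -/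
theorem hasDerivAt_pathForm_deriv {A A₁ A₂ B₁ B₂ : ℝ → ℝ} {p d Δ : EuclideanSpace ℝ (Fin 3)} {t : ℝ} (h0 : segR p d t ≠ 0)
    (hA : HasDerivAt A (A₁ (segR p d t)) (segR p d t)) (hA₁ : HasDerivAt A₁ (A₂ (segR p d t)) (segR p d t))
    (hB₁ : HasDerivAt B₁ (B₂ (segR p d t)) (segR p d t)) :
    HasDerivAt (fun s : ℝ => A₁ (segR p d s) * segS p d s * ⟪p + s • d, Δ⟫ ^ 2 + 2 * A (segR p d s) * (⟪p + s • d, Δ⟫ * ⟪d, Δ⟫) +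
        B₁ (segR p d s) * segS p d s * ‖Δ‖ ^ 2)
      ((A₂ (segR p d t) * segS p d t ^ 2 + A₁ (segR p d t) * ((‖d‖ ^ 2 * segR p d t - segN p d t * segS p d t) / segR p d t ^ 2)) *
          ⟪p + t • d, Δ⟫ ^ 2 +
        4 * A₁ (segR p d t) * segS p d t * (⟪p + t • d, Δ⟫ * ⟪d, Δ⟫) + 2 * A (segR p d t) * ⟪d, Δ⟫ ^ 2 +
        (B₂ (segR p d t) * segS p d t ^ 2 + B₁ (segR p d t) * ((‖d‖ ^ 2 * segR p d t - segN p d t * segS p d t) / segR p d t ^ 2)) *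
          ‖Δ‖ ^ 2) t := by
  have hρ := hasDerivAt_segR (p := p) (Δ := d) h0
  have hσ := hasDerivAt_segS (p := p) (Δ := d) h0
  have hAc : HasDerivAt (fun s => A (segR p d s)) (A₁ (segR p d t) * segS p d t) t := hA.comp t hρ
  have hA₁c : HasDerivAt (fun s => A₁ (segR p d s)) (A₂ (segR p d t) * segS p d t) t := hA₁.comp t hρ
  have hB₁c : HasDerivAt (fun s => B₁ (segR p d s)) (B₂ (segR p d t) * segS p d t) t := hB₁.comp t hρ
  have hu := hasDerivAt_inner_path p d Δ t
  have h1 := (hA₁c.mul hσ).mul (hu.mul hu)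
  have h2 := (hAc.const_mul (2 : ℝ)).mul (hu.mul_const ⟪d, Δ⟫)
  have h3 := (hB₁c.mul hσ).mul_const (‖Δ‖ ^ 2)
  have h := (h1.add h2).add h3
  have hfun : (fun s : ℝ => A₁ (segR p d s) * segS p d s * ⟪p + s • d, Δ⟫ ^ 2 + 2 * A (segR p d s) * (⟪p + s • d, Δ⟫ * ⟪d, Δ⟫) +
        B₁ (segR p d s) * segS p d s * ‖Δ‖ ^ 2) =
      fun s => A₁ (segR p d s) * segS p d s * (⟪p + s • d, Δ⟫ * ⟪p + s • d, Δ⟫) + 2 * A (segR p d s) * (⟪p + s • d, Δ⟫ * ⟪d, Δ⟫) +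
        B₁ (segR p d s) * segS p d s * ‖Δ‖ ^ 2 := by
    funext s; ring
  rw [hfun]
  exact h.congr_deriv (by simp only [Pi.mul_apply]; ring)

/-! ## §3. The pointwise one-sided floor of `g″` -/

/-- `x·y ≥ −[x]₋·Y` for `0 ≤ y ≤ Y`, `[x]₋ = max 0 (−x)`. [arithmetic] -/
theorem mul_ge_neg_negPart_mul {x y Y : ℝ} (hy : 0 ≤ y) (hY : y ≤ Y) : -(max 0 (-x) * Y) ≤ x * y := by
  rcases le_or_gt 0 x with hx | hx
  · rw [max_eq_left (by linarith)]; nlinarith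
  · rw [max_eq_right (by linarith)]; nlinarith

/-- ★ **Pointwise floor of the second derivative.**  At a path parameter with radius `ρ > 0`, slope `σ` (`σ² ≤ ‖d‖²`), `σ′ ∈ [0, ‖d‖²/ρ]`,
`u² ≤ ρ²‖Δ‖²`, `|u⟪d,Δ⟫| ≤ ρ‖d‖‖Δ‖²`, `⟪d,Δ⟫² ≤ ‖d‖²‖Δ‖²`, and coefficient values `A0, A1, A2, B1, B2` with
`[A2]₋ρ² + [A1]₋ρ + 4|A1|ρ + 2[A0]₋ + [B2]₋ + [B1]₋/ρ ≤ K`: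
`−K‖d‖²‖Δ‖² ≤ (A2σ² + A1σ′)u² + 4A1σ·u⟪d,Δ⟫ + 2A0⟪d,Δ⟫² + (B2σ² + B1σ′)‖Δ‖²`. [folklore] -/
theorem secondDeriv_floor {A0 A1 A2 B1 B2 K ρ σ τ u m nd nΔ : ℝ} (hρ : 0 < ρ) (hnd : 0 ≤ nd)
    (hσ : σ ^ 2 ≤ nd ^ 2) (hτ0 : 0 ≤ τ) (hτ : τ ≤ nd ^ 2 / ρ) (hu : u ^ 2 ≤ ρ ^ 2 * nΔ ^ 2) (hum : |u * m| ≤ ρ * nd * nΔ ^ 2)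
    (hm : m ^ 2 ≤ nd ^ 2 * nΔ ^ 2)
    (hK : max 0 (-A2) * ρ ^ 2 + max 0 (-A1) * ρ + 4 * |A1| * ρ + 2 * max 0 (-A0) + max 0 (-B2) + max 0 (-B1) / ρ ≤ K) :
    -(K * nd ^ 2 * nΔ ^ 2) ≤ (A2 * σ ^ 2 + A1 * τ) * u ^ 2 + 4 * A1 * σ * (u * m) + 2 * A0 * m ^ 2 + (B2 * σ ^ 2 + B1 * τ) * nΔ ^ 2 := by
  -- the six products and their ranges
  have hσu : 0 ≤ σ ^ 2 * u ^ 2 ∧ σ ^ 2 * u ^ 2 ≤ nd ^ 2 * ρ ^ 2 * nΔ ^ 2 :=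
    ⟨by positivity, by nlinarith [sq_nonneg σ, sq_nonneg u]⟩
  have hτu : 0 ≤ τ * u ^ 2 ∧ τ * u ^ 2 ≤ nd ^ 2 * ρ * nΔ ^ 2 := by
    refine ⟨by positivity, ?_⟩
    calc τ * u ^ 2 ≤ nd ^ 2 / ρ * (ρ ^ 2 * nΔ ^ 2) := mul_le_mul hτ hu (sq_nonneg _) (by positivity)
      _ = nd ^ 2 * ρ * nΔ ^ 2 := by field_simp
  have hσΔ : 0 ≤ σ ^ 2 * nΔ ^ 2 ∧ σ ^ 2 * nΔ ^ 2 ≤ nd ^ 2 * nΔ ^ 2 := ⟨by positivity, by nlinarith [sq_nonneg nΔ]⟩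
  have hτΔ : 0 ≤ τ * nΔ ^ 2 ∧ τ * nΔ ^ 2 ≤ nd ^ 2 / ρ * nΔ ^ 2 := ⟨by positivity, mul_le_mul_of_nonneg_right hτ (sq_nonneg _)⟩
  have t1 := mul_ge_neg_negPart_mul (x := A2) hσu.1 hσu.2
  have t2 := mul_ge_neg_negPart_mul (x := A1) hτu.1 hτu.2
  have t4 := mul_ge_neg_negPart_mul (x := A0) (sq_nonneg m) hm
  have t5 := mul_ge_neg_negPart_mul (x := B2) hσΔ.1 hσΔ.2
  have t6 := mul_ge_neg_negPart_mul (x := B1) hτΔ.1 hτΔ.2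
  -- the indefinite term
  have t3 : -(4 * |A1| * ρ * nd ^ 2 * nΔ ^ 2) ≤ 4 * A1 * σ * (u * m) := by
    have hσa : |σ| ≤ nd := abs_le_of_sq_le_sq hσ hnd
    have h1 : |4 * A1 * σ * (u * m)| ≤ 4 * |A1| * ρ * nd ^ 2 * nΔ ^ 2 := by
      rw [abs_mul, abs_mul, abs_mul, abs_of_pos (by norm_num : (0 : ℝ) < 4)]
      calc 4 * |A1| * |σ| * |u * m| ≤ 4 * |A1| * nd * (ρ * nd * nΔ ^ 2) :=
            mul_le_mul (mul_le_mul_of_nonneg_left hσa (by positivity)) hum (abs_nonneg _) (by positivity)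
        _ = 4 * |A1| * ρ * nd ^ 2 * nΔ ^ 2 := by ring
    linarith [neg_abs_le (4 * A1 * σ * (u * m))]
  -- collect: the bracket times `nd² nΔ² ≥ 0` is at most `K nd² nΔ²`
  have hw : 0 ≤ nd ^ 2 * nΔ ^ 2 := by positivity
  have hcollect : (max 0 (-A2) * ρ ^ 2 + max 0 (-A1) * ρ + 4 * |A1| * ρ + 2 * max 0 (-A0) + max 0 (-B2) + max 0 (-B1) / ρ) *
      (nd ^ 2 * nΔ ^ 2) ≤ K * (nd ^ 2 * nΔ ^ 2) := mul_le_mul_of_nonneg_right hK hw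
  have hexp : (max 0 (-A2) * ρ ^ 2 + max 0 (-A1) * ρ + 4 * |A1| * ρ + 2 * max 0 (-A0) + max 0 (-B2) + max 0 (-B1) / ρ) *
      (nd ^ 2 * nΔ ^ 2) =
      max 0 (-A2) * (nd ^ 2 * ρ ^ 2 * nΔ ^ 2) + max 0 (-A1) * (nd ^ 2 * ρ * nΔ ^ 2) + 4 * |A1| * ρ * nd ^ 2 * nΔ ^ 2 +
        2 * (max 0 (-A0) * (nd ^ 2 * nΔ ^ 2)) + max 0 (-B2) * (nd ^ 2 * nΔ ^ 2) + max 0 (-B1) * (nd ^ 2 / ρ * nΔ ^ 2) := by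
    ring
  rw [hexp] at hcollect
  nlinarith [t1, t2, t3, t4, t5, t6, hcollect]

/-! ## §4. ★★★ The one-sided second-order expansion -/

/-- ★★★ **ONE-SIDED SECOND-ORDER EXPANSION OF THE PER-LABEL CURVATURE FORM.**  Tube `a < ‖p + t d‖ < b` for `t ∈ [0,1]` (`a > 0`); on `(a, b)`:
`A′ = A₁`, `A₁′ = A₂`, `B′ = B₁`, `B₁′ = B₂` and the one-sided coefficient bound `[A₂]₋r² + [A₁]₋r + 4|A₁|r + 2[A]₋ + [B₂]₋ + [B₁]₋/r ≤ K`.  Then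
`A(‖p‖)⟪p,Δ⟫² + B(‖p‖)‖Δ‖² + (A₁(‖p‖)(⟪p,d⟫/‖p‖)⟪p,Δ⟫² + 2A(‖p‖)⟪p,Δ⟫⟪d,Δ⟫ + B₁(‖p‖)(⟪p,d⟫/‖p‖)‖Δ‖²) − (K/2)‖d‖²‖Δ‖²
 ≤ A(‖p + d‖)⟪p + d,Δ⟫² + B(‖p + d‖)‖Δ‖²`. [folklore: Taylor with one-sided second-order remainder via monotonicity] -/
theorem pathForm_secondOrder {A A₁ A₂ B B₁ B₂ : ℝ → ℝ} {a b K : ℝ} {p d Δ : EuclideanSpace ℝ (Fin 3)} (ha : 0 < a)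
    (htube : ∀ t ∈ Set.Icc (0 : ℝ) 1, a < segR p d t ∧ segR p d t < b)
    (hA : ∀ r, a < r → r < b → HasDerivAt A (A₁ r) r) (hA₁ : ∀ r, a < r → r < b → HasDerivAt A₁ (A₂ r) r)
    (hB : ∀ r, a < r → r < b → HasDerivAt B (B₁ r) r) (hB₁ : ∀ r, a < r → r < b → HasDerivAt B₁ (B₂ r) r)
    (hK : ∀ r, a < r → r < b →
      max 0 (-A₂ r) * r ^ 2 + max 0 (-A₁ r) * r + 4 * |A₁ r| * r + 2 * max 0 (-A r) + max 0 (-B₂ r) + max 0 (-B₁ r) / r ≤ K) :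
    A ‖p‖ * ⟪p, Δ⟫ ^ 2 + B ‖p‖ * ‖Δ‖ ^ 2 +
        (A₁ ‖p‖ * (⟪p, d⟫ / ‖p‖) * ⟪p, Δ⟫ ^ 2 + 2 * A ‖p‖ * (⟪p, Δ⟫ * ⟪d, Δ⟫) + B₁ ‖p‖ * (⟪p, d⟫ / ‖p‖) * ‖Δ‖ ^ 2) -
        K / 2 * ‖d‖ ^ 2 * ‖Δ‖ ^ 2 ≤
      A ‖p + d‖ * ⟪p + d, Δ⟫ ^ 2 + B ‖p + d‖ * ‖Δ‖ ^ 2 := by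
  -- the path functions
  set g : ℝ → ℝ := fun s => A (segR p d s) * ⟪p + s • d, Δ⟫ ^ 2 + B (segR p d s) * ‖Δ‖ ^ 2 with hg
  set g1 : ℝ → ℝ := fun s => A₁ (segR p d s) * segS p d s * ⟪p + s • d, Δ⟫ ^ 2 + 2 * A (segR p d s) * (⟪p + s • d, Δ⟫ * ⟪d, Δ⟫) +
    B₁ (segR p d s) * segS p d s * ‖Δ‖ ^ 2 with hg1
  set g2 : ℝ → ℝ := fun t =>
    (A₂ (segR p d t) * segS p d t ^ 2 + A₁ (segR p d t) * ((‖d‖ ^ 2 * segR p d t - segN p d t * segS p d t) / segR p d t ^ 2)) *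
        ⟪p + t • d, Δ⟫ ^ 2 +
      4 * A₁ (segR p d t) * segS p d t * (⟪p + t • d, Δ⟫ * ⟪d, Δ⟫) + 2 * A (segR p d t) * ⟪d, Δ⟫ ^ 2 +
      (B₂ (segR p d t) * segS p d t ^ 2 + B₁ (segR p d t) * ((‖d‖ ^ 2 * segR p d t - segN p d t * segS p d t) / segR p d t ^ 2)) *
        ‖Δ‖ ^ 2 with hg2
  set L : ℝ := K * ‖d‖ ^ 2 * ‖Δ‖ ^ 2 with hL
  -- derivatives and the floor along the tube
  have hpos : ∀ t ∈ Set.Icc (0 : ℝ) 1, 0 < segR p d t := fun t ht => ha.trans (htube t ht).1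
  have hd1 : ∀ t ∈ Set.Icc (0 : ℝ) 1, HasDerivAt g (g1 t) t := fun t ht =>
    hasDerivAt_pathForm (hpos t ht).ne' (hA _ (htube t ht).1 (htube t ht).2) (hB _ (htube t ht).1 (htube t ht).2)
  have hd2 : ∀ t ∈ Set.Icc (0 : ℝ) 1, HasDerivAt g1 (g2 t) t := fun t ht =>
    hasDerivAt_pathForm_deriv (hpos t ht).ne' (hA _ (htube t ht).1 (htube t ht).2) (hA₁ _ (htube t ht).1 (htube t ht).2)
      (hB₁ _ (htube t ht).1 (htube t ht).2)
  have hfl : ∀ t ∈ Set.Icc (0 : ℝ) 1, -L ≤ g2 t := by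
    intro t ht
    have h0 := hpos t ht
    have hτ := segS_deriv_bounds (p := p) (d := d) h0
    exact secondDeriv_floor h0 (norm_nonneg d) (segS_sq_le h0) hτ.1 hτ.2 (inner_path_sq_le p d Δ t)
      (abs_inner_path_mul_le p d Δ t) (inner_sq_le_norm d Δ) (hK _ (htube t ht).1 (htube t ht).2)
  -- step 1: `ψ = g1 + L·id` is non-decreasing, so `g1 0 ≤ g1 t + L t`
  have hψ : ∀ t ∈ Set.Icc (0 : ℝ) 1, g1 0 ≤ g1 t + L * t := by
    intro t ht
    have hsub : ∀ s ∈ Set.Icc (0 : ℝ) t, s ∈ Set.Icc (0 : ℝ) 1 := fun s hs => ⟨hs.1, hs.2.trans ht.2⟩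
    have hder : ∀ s ∈ Set.Icc (0 : ℝ) t, HasDerivAt (fun x => g1 x + L * x) (g2 s + L) s := fun s hs =>
      ((hd2 s (hsub s hs)).add ((hasDerivAt_id' s).const_mul L)).congr_deriv (by ring)
    have hcont : ContinuousOn (fun x => g1 x + L * x) (Set.Icc 0 t) := fun s hs => (hder s hs).continuousAt.continuousWithinAt
    have key := le_of_deriv_nonneg_piece ht.1 hcont (fun s hs => hder s (Set.Ioo_subset_Icc_self hs))
      (fun s hs => by linarith [hfl s (hsub s (Set.Ioo_subset_Icc_self hs))])
    simpa using key
  -- step 2: `φ = g − g1(0)·id + (L/2)·id²` is non-decreasing on `[0,1]`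
  have hφder : ∀ t ∈ Set.Icc (0 : ℝ) 1, HasDerivAt (fun x => g x - g1 0 * x + L / 2 * (x * x)) (g1 t - g1 0 + L * t) t := by
    intro t ht
    have h := ((hd1 t ht).sub ((hasDerivAt_id' t).const_mul (g1 0))).add (((hasDerivAt_id' t).mul (hasDerivAt_id' t)).const_mul (L / 2))
    exact h.congr_deriv (by ring)
  have hφcont : ContinuousOn (fun x => g x - g1 0 * x + L / 2 * (x * x)) (Set.Icc 0 1) :=
    fun s hs => (hφder s hs).continuousAt.continuousWithinAt
  have hφ := le_of_deriv_nonneg_piece zero_le_one hφcont (fun s hs => hφder s (Set.Ioo_subset_Icc_self hs))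
    (fun s hs => by linarith [hψ s (Set.Ioo_subset_Icc_self hs)])
  -- evaluate at the endpoints
  have hR0 : segR p d 0 = ‖p‖ := by simp [segR]
  have hR1 : segR p d 1 = ‖p + d‖ := by simp [segR]
  have hS0 : segS p d 0 = ⟪p, d⟫ / ‖p‖ := by simp [segS, segN, segR]
  have hg0 : g 0 = A ‖p‖ * ⟪p, Δ⟫ ^ 2 + B ‖p‖ * ‖Δ‖ ^ 2 := by simp [hg, hR0]
  have hgone : g 1 = A ‖p + d‖ * ⟪p + d, Δ⟫ ^ 2 + B ‖p + d‖ * ‖Δ‖ ^ 2 := by simp [hg, hR1]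
  have hg10 : g1 0 = A₁ ‖p‖ * (⟪p, d⟫ / ‖p‖) * ⟪p, Δ⟫ ^ 2 + 2 * A ‖p‖ * (⟪p, Δ⟫ * ⟪d, Δ⟫) + B₁ ‖p‖ * (⟪p, d⟫ / ‖p‖) * ‖Δ‖ ^ 2 := by
    simp [hg1, hR0, hS0]
  have hφ' : g 0 ≤ g 1 - g1 0 + L / 2 := by
    have := hφ
    simp only [mul_zero, sub_zero, add_zero, mul_one] at this
    linarith
  rw [hg0, hgone, hg10] at hφ'
  rw [hL] at hφ'
  linarith

end Summit.AtomisticToContinuum.Crystallization.Theorems.FrustratedLawDichotomyStrainedPatchHomHessPath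

end
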